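import Summits.NavierStokesRegularity.FunctionalMining.PressureMomentRateRpow
import Summits.NavierStokesRegularity.FunctionalMining.GradientTransport
import HarnessLib

/-!
# FunctionalMining — the pressure-gradient moment `∫|∇p|²` and its exact rate along classical solutions

Search for candidate a priori estimates; no regularity claim. Cell `pub-nsfunc`, prove seat
(gen 10). K0 family `EP.gradp.q` (pressure-gradient moments `∫|∇p|^q`; row `EP.gradp.q=2`): the
functional `torusGradPressureMoment q v := ∫ ‖∇π_v‖^q` of the zero-mean pressure `π_v`
(`PressureFunctional`), and at `q = 2` its exact rate along every classical unforced solution on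
`T^d × [a, b]`:

`d/dt ∫|∇π|² = 2∫ ∇π·∇∂ₜπ = −2∫ π Δ∂ₜπ = −2∫ π (νA_u + B_u)`

(integration by parts; `∂ₜπ = Δ⁻¹(νA_u + B_u)`, `ΔΔ⁻¹h = h − ∫h`, `∫π = 0`; `A_v = −2∑ᵢⱼ∂ᵢ(Δv)ⱼ∂ⱼvᵢ`
is `pressureSqViscousSource`). Packaged as `HasInitialRate (torusGradPressureMoment 2) N V` with the
viscous rate `V(v) = −2∫ π_v A_v` (`gradPressureSqViscousRate`) for the heat sieve. Identities along
smooth solutions only.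
-/

noncomputable section

open MeasureTheory Finset Set Filter Topology
open scoped InnerProductSpace RealInnerProductSpace ContDiff

namespace Summit.NavierStokesRegularity.FunctionalMining

open Literature.Analysis.FunctionSpaces Literature.Analysis.FluidPDE

variable {d : Type*} [Fintype d] [DecidableEq d]

/-! ## 1. Definitions -/

/-- **K0 family `EP.gradp.q`: the pressure-gradient moment `∫_{T^d} ‖∇π_v‖^q`** (real power;
`π_v = pressureOf v` the zero-mean pressure). Search for candidate a priori estimates; no regularity
claim. [ours; packaging] -/
def torusGradPressureMoment (q : ℝ) (v : UnitAddTorus d → EuclideanSpace ℝ d) : ℝ :=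
  ∫ x, ‖Torus.gradient (pressureOf v) x‖ ^ q

/-- **Viscous (heat-flow) rate of `∫|∇π|²`**: `V(v) = −2∫ π_v A_v`. [ours; bookkeeping] -/
def gradPressureSqViscousRate (v : UnitAddTorus d → EuclideanSpace ℝ d) : ℝ :=
  -2 * ∫ x, pressureOf v x * pressureSqViscousSource v x

/-- **Inertial rate of `∫|∇π|²`**: `N(v) = −2∫ π_v B_v`. [ours; bookkeeping] -/
def gradPressureSqInertialRate (v : UnitAddTorus d → EuclideanSpace ℝ d) : ℝ :=
  -2 * ∫ x, pressureOf v x * pressureSqInertialSource v x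

/-- `∫|∇π|^q ≥ 0`. [folklore] -/
theorem torusGradPressureMoment_nonneg (q : ℝ) (v : UnitAddTorus d → EuclideanSpace ℝ d) :
    0 ≤ torusGradPressureMoment q v :=
  integral_nonneg fun _ => Real.rpow_nonneg (norm_nonneg _) _

/-- `‖∇θ(x)‖² = ∑ⱼ ∂ⱼθ(x)·∂ⱼθ(x)` for `C¹` `θ`. [folklore] -/
theorem norm_gradient_sq_eq_sum {θ : UnitAddTorus d → ℝ} (hθ : Torus.IsContDiff 1 θ) (x : UnitAddTorus d) :
    ‖Torus.gradient θ x‖ ^ 2 = ∑ j, Torus.partialDeriv j θ x * Torus.partialDeriv j θ x := by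
  rw [EuclideanSpace.norm_sq_eq]
  refine Finset.sum_congr rfl fun j _ => ?_
  rw [GradientTensor.gradient_apply_eq_partialDeriv hθ, Real.norm_eq_abs, sq_abs, sq]

/-- At `q = 2`, for smooth `v`, the functional is `∫ ∑ⱼ (∂ⱼπ)²`. [folklore] -/
theorem torusGradPressureMoment_two {v : UnitAddTorus d → EuclideanSpace ℝ d} (hv : Torus.IsSmooth v) :
    torusGradPressureMoment 2 v =
      ∫ x, ∑ j, Torus.partialDeriv j (pressureOf v) x * Torus.partialDeriv j (pressureOf v) x := by
  unfold torusGradPressureMoment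
  refine integral_congr_ae (ae_of_all _ fun x => ?_)
  show ‖Torus.gradient (pressureOf v) x‖ ^ (2 : ℝ) = _
  rw [Real.rpow_two, norm_gradient_sq_eq_sum ((isSmooth_pressureOf hv).isContDiff (by simp))]

/-! ## 2. The exact rate -/

/-- **`d/dt ∫|∇π|² = N + νV` along classical unforced solutions on `T^d`.** [ours] -/
theorem hasDerivWithinAt_torusGradPressureMoment_two [Nonempty d] {a b ν : ℝ}
    {u : ℝ → UnitAddTorus d → EuclideanSpace ℝ d} {p : ℝ → UnitAddTorus d → ℝ}
    (h : Torus.IsClassicalNSSolutionOn (Icc a b) ν 0 u p) (hab : a < b) {t : ℝ} (ht : t ∈ Icc a b) :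
    HasDerivWithinAt (fun s => torusGradPressureMoment 2 (u s))
      (gradPressureSqInertialRate (u t) + ν * gradPressureSqViscousRate (u t)) (Icc a b) t := by
  have hU : UniqueDiffOn ℝ (Icc a b) := uniqueDiffOn_Icc hab
  have hint : (interior (Icc a b)).Nonempty := by
    rw [interior_Icc]; exact nonempty_Ioo.2 hab
  have hu : Torus.IsSmoothSpaceTimeOn (Icc a b) u := h.smooth_velocity
  have hus : ∀ s ∈ Icc a b, Torus.IsSmooth (u s) := fun s hs => hu.isSmooth_slice hs
  have hut : Torus.IsSmooth (u t) := hus t ht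
  have hσ : Torus.IsSmoothSpaceTimeOn (Icc a b) (fun s x => -gradSqTrace (u s) x) := by
    have h1 : Torus.IsSmoothSpaceTimeOn (Icc a b) (fun s x => gradSqTrace (u s) x) :=
      Torus.IsSmoothSpaceTimeOn.sum fun i _ => Torus.IsSmoothSpaceTimeOn.sum fun j _ =>
        ((hu.partialDeriv hU i).apply j).mul ((hu.partialDeriv hU j).apply i)
    exact h1.neg
  have hP : Torus.IsSmoothSpaceTimeOn (Icc a b) (fun s => pressureOf (u s)) :=
    hσ.invLaplacian (convex_Icc a b) hint
  have hθ : ∀ j, Torus.IsSmoothSpaceTimeOn (Icc a b) (fun s => Torus.partialDeriv j (pressureOf (u s))) :=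
    fun j => hP.partialDeriv hU j
  -- work with `G(s) = ∫ ∑ⱼ θⱼ²` and transfer on the window
  have hΘ : Torus.IsSmoothSpaceTimeOn (Icc a b) (fun s x => ∑ j,
      Torus.partialDeriv j (pressureOf (u s)) x * Torus.partialDeriv j (pressureOf (u s)) x) :=
    Torus.IsSmoothSpaceTimeOn.sum fun j _ => (hθ j).mul (hθ j)
  have hD := hΘ.hasDerivWithinAt_integral (convex_Icc a b) ht
  refine (hD.congr_deriv ?_).congr (fun s hs => torusGradPressureMoment_two (hus s hs))
    (torusGradPressureMoment_two hut)
  -- `W = ∂ₜπ` and its Laplacian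
  set W : UnitAddTorus d → ℝ := Torus.timeDerivWithin (Icc a b) (fun s => pressureOf (u s)) t with hW
  have hWs : Torus.IsSmooth W := hP.isSmooth_timeDerivWithin hU ht
  have hA : Torus.IsSmooth (pressureSqViscousSource (u t)) := isSmooth_pressureSqViscousSource hut
  have hB : Torus.IsSmooth (pressureSqInertialSource (u t)) := isSmooth_pressureSqInertialSource hut
  have hAB : Torus.IsSmooth (fun x => ν * pressureSqViscousSource (u t) x + pressureSqInertialSource (u t) x) :=
    (contDiff_const.mul hA).add hB
  have hWeq : W = Torus.invLaplacian
      (fun x => ν * pressureSqViscousSource (u t) x + pressureSqInertialSource (u t) x) := by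
    funext x
    have e3 : Torus.timeDerivWithin (Icc a b) (fun s => pressureOf (u s)) t x =
        Torus.invLaplacian (Torus.timeDerivWithin (Icc a b) (fun s y => -gradSqTrace (u s) y) t) x :=
      Torus.timeDerivWithin_invLaplacian hab hσ ht x
    rw [hW, e3, timeDerivWithin_neg_gradSqTrace h hab ht]
  have hΔW : ∀ x, Torus.laplacian W x =
      (ν * pressureSqViscousSource (u t) x + pressureSqInertialSource (u t) x) -
        ∫ y, (ν * pressureSqViscousSource (u t) y + pressureSqInertialSource (u t) y) := by
    intro x
    rw [hWeq]
    exact Torus.laplacian_invLaplacian hAB x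
  -- pointwise time derivative of `∑ⱼ θⱼ²`
  have hslice : ∀ x, Torus.timeDerivWithin (Icc a b) (fun s y => ∑ j,
      Torus.partialDeriv j (pressureOf (u s)) y * Torus.partialDeriv j (pressureOf (u s)) y) t x =
      ∑ j, 2 * Torus.partialDeriv j (pressureOf (u t)) x * Torus.partialDeriv j W x := by
    intro x
    have h1 : ∀ j, HasDerivWithinAt (fun s => Torus.partialDeriv j (pressureOf (u s)) x)
        (Torus.partialDeriv j W x) (Icc a b) t := by
      intro j
      have h0 := (hθ j).hasDerivWithinAt_slice ht x
      rw [Torus.timeDerivWithin_partialDeriv_comm hab hP ht j x] at h0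
      exact h0
    have h2 := HasDerivWithinAt.fun_sum (u := Finset.univ) fun j _ => (h1 j).fun_mul (h1 j)
    rw [Torus.timeDerivWithin, h2.derivWithin (hU t ht)]
    exact Finset.sum_congr rfl fun j _ => by ring
  simp_rw [hslice]
  -- integrate by parts: `∑ⱼ ∫ 2∂ⱼπ ∂ⱼW = −2 ∫ π ΔW`
  have hπ : Torus.IsSmooth (pressureOf (u t)) := isSmooth_pressureOf hut
  have hint_j : ∀ j, Integrable (fun x => 2 * Torus.partialDeriv j (pressureOf (u t)) x *
      Torus.partialDeriv j W x) := fun j =>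
    ((continuous_const.mul (hπ.partialDeriv j).continuous).mul (hWs.partialDeriv j).continuous).integrable_unitAddTorus
  rw [integral_finsetSum _ fun j _ => hint_j j]
  have hIBP : ∀ j, ∫ x, 2 * Torus.partialDeriv j (pressureOf (u t)) x * Torus.partialDeriv j W x =
      -2 * ∫ x, pressureOf (u t) x * Torus.partialDeriv j (Torus.partialDeriv j W) x := by
    intro j
    have h1 := Torus.integral_partialDeriv_mul_eq_neg_integral hπ (hWs.partialDeriv j) j
    have e : (fun x => 2 * Torus.partialDeriv j (pressureOf (u t)) x * Torus.partialDeriv j W x) =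
        fun x => 2 * (Torus.partialDeriv j (pressureOf (u t)) x * Torus.partialDeriv j W x) := by
      funext x; ring
    rw [e, integral_const_mul, h1]
    ring
  simp_rw [hIBP]
  rw [← Finset.mul_sum, ← integral_finsetSum Finset.univ
    (f := fun j x => pressureOf (u t) x * Torus.partialDeriv j (Torus.partialDeriv j W) x)
    (fun j _ => (hπ.continuous.mul ((hWs.partialDeriv j).partialDeriv j).continuous).integrable_unitAddTorus)]
  have hsumΔ : ∀ x, ∑ j, pressureOf (u t) x * Torus.partialDeriv j (Torus.partialDeriv j W) x =
      pressureOf (u t) x * Torus.laplacian W x := by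
    intro x
    rw [Torus.laplacian_eq_sum_partialDeriv_partialDeriv hWs, Finset.mul_sum]
  simp_rw [hsumΔ, hΔW]
  -- `∫ π (h − c) = ∫ π h` since `∫π = 0`
  obtain ⟨c, hc⟩ : ∃ c : ℝ, c = ∫ y, (ν * pressureSqViscousSource (u t) y + pressureSqInertialSource (u t) y) :=
    ⟨_, rfl⟩
  rw [← hc]
  have iπA : Integrable (fun x => pressureOf (u t) x * pressureSqViscousSource (u t) x) :=
    (hπ.continuous.mul hA.continuous).integrable_unitAddTorus
  have iπB : Integrable (fun x => pressureOf (u t) x * pressureSqInertialSource (u t) x) :=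
    (hπ.continuous.mul hB.continuous).integrable_unitAddTorus
  have e2 : ∀ x, pressureOf (u t) x *
      (ν * pressureSqViscousSource (u t) x + pressureSqInertialSource (u t) x - c) =
      ν * (pressureOf (u t) x * pressureSqViscousSource (u t) x) +
        pressureOf (u t) x * pressureSqInertialSource (u t) x - c * pressureOf (u t) x := by
    intro x; ring
  simp_rw [e2]
  have i1 : Integrable (fun x => ν * (pressureOf (u t) x * pressureSqViscousSource (u t) x) +
      pressureOf (u t) x * pressureSqInertialSource (u t) x) := (iπA.const_mul ν).add iπB
  have i2 : Integrable (fun x => c * pressureOf (u t) x) :=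
    hπ.continuous.integrable_unitAddTorus.const_mul c
  have i3 : Integrable (fun x => ν * (pressureOf (u t) x * pressureSqViscousSource (u t) x)) :=
    iπA.const_mul ν
  rw [integral_sub i1 i2, integral_add i3 iπB, integral_const_mul, integral_const_mul,
    integral_pressureOf hut, mul_zero, sub_zero, gradPressureSqViscousRate, gradPressureSqInertialRate]
  ring

/-- **The initial rates of the row `EP.gradp.q=2`**: `HasInitialRate (torusGradPressureMoment 2) N V`
on `T³`. [ours] -/
theorem hasInitialRate_torusGradPressureMoment_two :
    HasInitialRate (d := d) (torusGradPressureMoment 2) gradPressureSqInertialRate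
      gradPressureSqViscousRate := by
  intro hd ν _ a b hab u p hsol _
  haveI : Nonempty d := Fintype.card_pos_iff.mp (by omega)
  exact hasDerivWithinAt_torusGradPressureMoment_two hsol hab (left_mem_Icc.2 hab.le)

end Summit.NavierStokesRegularity.FunctionalMining
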